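import Literature.Analysis.FluidPDE.PassiveScalarDiagMildTails
import Literature.Analysis.FluidPDE.PassiveScalarDiagMildFixedPoint
import Literature.Analysis.FluidPDE.PassiveScalarDiagMildWeakForm
import Literature.Analysis.FluidPDE.UniversalTotalAnomalousDissipator
import HarnessLib

/-!
# Mild (Duhamel) formulation of the passive scalar equation with constant diagonal diffusion and
  bounded drift, IX: the undamped mild solution — weak class and strong `L²` continuity

Analysis/FluidPDE proof-support file (everything proved). From the natural hypotheses
(`T > 0`, `κ > 0`, `aᵢ > 0`, drift bound `U`, `θ₀ ∈ L²`) the Picard data with damping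
`λ = 2(∑ⱼaⱼ⁻¹)U²/κ + 1` (`MildData.ofDrift`); the undamped field `θ(t) = e^{λt}w(t)` of the damped fixed
point is an `L^∞_t L²_x` field with continuous coefficients solving the undamped mild equation
(`MildData.exists_mildSolution`); a mild solution lies in the DiPerna–Lions weak class
`Torus.IsWeakScalarTransportDiagOn` (`isWeakScalarTransportDiagOn_of_mild`); **strong `L²` continuity
from continuous coefficients and uniformly small frequency tails** (`isL2ContinuousOn_of_coeff`, the
predicate `Torus.IsL2ContinuousOn` of `UniversalTotalAnomalousDissipator`); and the uniform tails of the
undamped mild solution (`MildData.undamp_tail`: datum tail by Parseval, Duhamel tail by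
`PassiveScalarDiagMildTails`).

## References

* A. Pazy, *Semigroups of Linear Operators and Applications to PDE*, Springer 1983, Ch. 4 §4.2
  (mild solutions, (2.3), Def. 2.3), Ch. 6 §6.1 Thm. 1.2 (Picard iteration for the mild equation).
* R. J. DiPerna, P.-L. Lions, Invent. Math. 98 (1989) 511–547, §II.1. L. C. Evans, *PDE* (2010), §7.1.2.
* L. Grafakos, *Classical Fourier Analysis*, 3rd ed. (2014), Prop. 3.2.6 (4), (8), Prop. 3.2.7 (3), §3.3.1.
* J. C. Robinson, J. L. Rodrigo, W. Sadowski, *The Three-Dimensional Navier–Stokes Equations* (2016), Thm. 4.11.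
-/

noncomputable section

open MeasureTheory TopologicalSpace Set Function Filter UnitAddTorus
open _root_.Topology
open scoped ENNReal NNReal InnerProductSpace ComplexConjugate

namespace Literature.Analysis.FluidPDE

namespace Torus

open Literature.Analysis.FunctionSpaces.Torus Literature.Analysis.FunctionSpaces

variable {d : Type*} [Fintype d]

/-! ## Existence: the undamped mild solution, its weak formulation and strong `L²` continuity -/

section Existence

variable [DecidableEq d]

namespace MildData

variable [Nonempty d] (P : MildData d)

/-- **Construction of the Picard data from the natural hypotheses**: the damping rate
`λ = 2(∑ⱼaⱼ⁻¹)U²/κ + 1` makes the contraction constant at most `1/2`. [cite: Pazy1983, Ch. 6 §6.1 Thm. 1.2 (proof: Picard iteration), p. 184] -/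
def ofDrift {T κ U : ℝ} {a : d → ℝ} {u : ℝ → UnitAddTorus d → EuclideanSpace ℝ d} {θ₀ : UnitAddTorus d → ℝ}
    (hT : 0 < T) (hκ : 0 < κ) (ha : ∀ i, 0 < a i) (hu : DriftBound T u U) (hθ₀ : MemLp θ₀ 2 volume) :
    MildData d where
  T := T
  κ := κ
  lam := 2 * (∑ j, (a j)⁻¹) * U ^ 2 / κ + 1
  U := U
  a := a
  u := u
  θ₀ := θ₀
  hT := hT
  hκ := hκ
  hlam := by
    have : 0 ≤ ∑ j, (a j)⁻¹ := Finset.sum_nonneg fun j _ => inv_nonneg.2 (ha j).le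
    positivity
  ha := ha
  hu := hu
  hθ₀ := hθ₀
  hq := by
    set S : ℝ := ∑ j, (a j)⁻¹ with hS'
    have hS : 0 ≤ S := Finset.sum_nonneg fun j _ => inv_nonneg.2 (ha j).le
    have hpos : 0 < 2 * κ * (2 * S * U ^ 2 / κ + 1) := by positivity
    rw [div_le_div_iff₀ hpos (by norm_num : (0 : ℝ) < 4), one_mul]
    have e : 2 * κ * (2 * S * U ^ 2 / κ + 1) = 4 * (S * U ^ 2) + 2 * κ := by
      field_simp
      ring
    rw [e]
    nlinarith [mul_nonneg hS (sq_nonneg U), hκ.le]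

/-- **The undamped mild solution** `θ(t) = e^{λt} w(t)` built from the damped fixed point `w`. [cite: Pazy1983, Ch. 4 §4.2, (2.3) and Def. 2.3 (mild solution), p. 106] -/
def undamp (w : ℝ → UnitAddTorus d → ℝ) : ℝ → UnitAddTorus d → ℝ := fun t x => Real.exp (P.lam * t) * w t x

omit [DecidableEq d] [Nonempty d] in
/-- Fourier coefficients of the undamped field: `𝓕(e^{λt}w(t))(k) = e^{λt} 𝓕(w(t))(k)`. [cite: Grafakos2014, Prop. 3.2.6 (4)] -/
theorem mFourierCoeff_undamp (w : ℝ → UnitAddTorus d → ℝ) (t : ℝ) (k : d → ℤ) :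
    mFourierCoeff (fun x => (P.undamp w t x : ℂ)) k =
      ((Real.exp (P.lam * t) : ℝ) : ℂ) * mFourierCoeff (fun x => (w t x : ℂ)) k := by
  have e : (fun x => (P.undamp w t x : ℂ)) = ((Real.exp (P.lam * t) : ℝ) : ℂ) • fun x => ((w t x : ℝ) : ℂ) := by
    funext x; simp only [undamp, Pi.smul_apply, smul_eq_mul]; push_cast; ring
  rw [e, mFourierCoeff_const_smul, smul_eq_mul]

/-- **The undamped mild solution and its properties**: an `L^∞_t L²_x` field on `[0,T]` (bound
`e^{2λT} B²`), with time-continuous Fourier coefficients, satisfying the undamped mild equation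
`𝓕(θ(t))(k) = e^{-νₖt} θ̂₀(k) - ∫_{(0,t]} e^{-νₖ(t-s)} N(θ)(s)(k) ds` on `[0,T]`. [cite: Pazy1983, Ch. 4 §4.2, (2.3) and Def. 2.3 (mild solution), p. 106] -/
theorem exists_mildSolution :
    ∃ θ : ℝ → UnitAddTorus d → ℝ, IsL2Field P.T (Real.exp (P.lam * P.T) ^ 2 * P.B ^ 2) θ ∧
      (∀ k, ContinuousOn (fun t => mFourierCoeff (fun x => (θ t x : ℂ)) k) (Icc 0 P.T)) ∧
      ∀ t ∈ Icc 0 P.T, ∀ k,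
        mFourierCoeff (fun x => (θ t x : ℂ)) k = mildMap P.κ P.a 0 P.u P.θ₀ θ t k := by
  obtain ⟨w, hw, hwc, hweq⟩ := P.exists_dampedMildSolution
  refine ⟨P.undamp w, ?_, fun k => ?_, fun t ht k => ?_⟩
  · refine hw.mul_continuous (f := fun t => Real.exp (P.lam * t)) (by fun_prop) fun t ht => ?_
    exact pow_le_pow_left₀ (Real.exp_pos _).le (Real.exp_le_exp.2
      (mul_le_mul_of_nonneg_left ht.2 P.hlam.le)) 2
  · have h : ContinuousOn (fun t => ((Real.exp (P.lam * t) : ℝ) : ℂ) * mFourierCoeff (fun x => (w t x : ℂ)) k)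
        (Icc 0 P.T) := (Complex.continuous_ofReal.comp (by fun_prop)).continuousOn.mul (hwc k)
    exact h.congr fun t _ => P.mFourierCoeff_undamp w t k
  · rw [P.mFourierCoeff_undamp w t k, hweq t ht k, mildMap_apply, mildMap_apply, mul_sub, ← mul_assoc,
      ← Complex.ofReal_mul, ← Real.exp_add, add_zero]
    congr 1
    · congr 2; ring
    · show ((Real.exp (P.lam * t) : ℝ) : ℂ) * duhamelCoeff P.κ P.a P.lam P.u w t k =
        duhamelCoeff P.κ P.a 0 P.u (fun t x => Real.exp (P.lam * t) * w t x) t k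
      rw [duhamelCoeff_zero_exp_mul]

end MildData

variable {T U E κ : ℝ} {a : d → ℝ} {u : ℝ → UnitAddTorus d → EuclideanSpace ℝ d}
  {θ : ℝ → UnitAddTorus d → ℝ} {θ₀ : UnitAddTorus d → ℝ}

/-- **A mild solution lies in the weak class** `Torus.IsWeakScalarTransportDiagOn`: an `L^∞_t L²_x`
field with continuous Fourier coefficients satisfying the undamped mild equation for a bounded,
weakly divergence-free drift is a weak (distributional) solution of
`∂ₜθ + u·∇θ = κ∑ᵢaᵢ∂ᵢ∂ᵢθ`, `θ(0) = θ₀` on `T^d × [0,T)` (the weak formulation is `weak_eq_of_mild`;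
the remaining clauses of the DiPerna–Lions class follow from the bounds). [cite: DiPernaLions1989, §II.1 (12)–(14)] -/
theorem isWeakScalarTransportDiagOn_of_mild (hT : 0 < T) (hκ : 0 ≤ κ) (ha : ∀ i, 0 < a i)
    (hu : MemLp (stLift u) ∞ (volume.restrict (Ioo 0 T ×ˢ univ))) (hU : DriftBound T u U)
    (hdiv : ∀ᵐ t ∂((volume : Measure ℝ).restrict (Ioo 0 T)), FunctionSpaces.Torus.IsWeaklyDivFree (u t))
    (hθ : IsL2Field T E θ) (hθ₀ : MemLp θ₀ 2 volume)
    (hcont : ∀ k, ContinuousOn (fun t => mFourierCoeff (fun x => (θ t x : ℂ)) k) (Icc 0 T))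
    (hmild : ∀ t ∈ Icc 0 T, ∀ k, mFourierCoeff (fun x => (θ t x : ℂ)) k = mildMap κ a 0 u θ₀ θ t k) :
    IsWeakScalarTransportDiagOn T a κ u θ₀ θ := by
  haveI : IsFiniteMeasure ((volume : Measure ℝ).restrict (Ioo 0 T)) :=
    isFiniteMeasure_restrict.2 measure_Ioo_lt_top.ne
  obtain ⟨Cu', -, hCu'⟩ := ae_ae_norm_le_of_memLp_top_stLift hu
  have hWb : ∀ᵐ t ∂((volume : Measure ℝ).restrict (Ioo 0 T)), ∫⁻ x, ‖θ t x‖ₑ ^ 2 ≤ (E.toNNReal : ℝ≥0∞) := by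
    filter_upwards [ae_restrict_mem measurableSet_Ioo] with t ht
    exact hθ.lintegral_sq_le (Ioo_subset_Icc_self ht)
  have hWs : ∀ᵐ t ∂((volume : Measure ℝ).restrict (Ioo 0 T)), AEStronglyMeasurable (θ t) volume :=
    hθ.aestronglyMeasurable.prodMk_left
  have hu2 : ∀ᵐ t ∂((volume : Measure ℝ).restrict (Ioo 0 T)), ∫⁻ x, ‖u t x‖ₑ ^ 2 ≤ ENNReal.ofReal Cu' ^ 2 := by
    filter_upwards [hCu'] with t ht
    calc ∫⁻ x, ‖u t x‖ₑ ^ 2 ≤ ∫⁻ _ : UnitAddTorus d, ENNReal.ofReal Cu' ^ 2 := by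
          refine lintegral_mono_ae ?_
          filter_upwards [ht] with x hx
          gcongr
          rw [← ofReal_norm]
          exact ENNReal.ofReal_le_ofReal hx
      _ = ENNReal.ofReal Cu' ^ 2 := by rw [lintegral_const, measure_univ, mul_one]
  refine ⟨aestronglyMeasurable_stLift_of_uncurry hθ.aestronglyMeasurable, hu.1, ⟨E.toNNReal, hWb⟩, ?_, ?_, hdiv,
    fun ψ hψ => weak_eq_of_mild hT hκ ha hU hθ hθ₀ hcont hmild hψ⟩
  · -- `u ∈ L¹(0,T; L²)`
    calc ∫⁻ t in Ioo 0 T, (∫⁻ x, ‖u t x‖ₑ ^ 2) ^ (1 / 2 : ℝ)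
        ≤ ∫⁻ _ in Ioo 0 T, (ENNReal.ofReal Cu' ^ 2) ^ (1 / 2 : ℝ) := by
          refine lintegral_mono_ae ?_
          filter_upwards [hu2] with t ht
          exact ENNReal.rpow_le_rpow ht (by norm_num)
      _ < ⊤ := by
          rw [lintegral_const, Measure.restrict_apply_univ]
          exact ENNReal.mul_lt_top (ENNReal.rpow_lt_top_of_nonneg (by norm_num)
            (ENNReal.pow_ne_top ENNReal.ofReal_ne_top)) measure_Ioo_lt_top
  · -- `u θ ∈ L¹((0,T) × T^d)`
    calc ∫⁻ t in Ioo 0 T, ∫⁻ x, ‖u t x‖ₑ * ‖θ t x‖ₑ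
        ≤ ∫⁻ _ in Ioo 0 T, ENNReal.ofReal Cu' * ((E.toNNReal : ℝ≥0∞)) ^ (1 / 2 : ℝ) := by
          refine lintegral_mono_ae ?_
          filter_upwards [hCu', hWb, hWs] with t ht htW htm
          calc ∫⁻ x, ‖u t x‖ₑ * ‖θ t x‖ₑ ≤ ∫⁻ x, ENNReal.ofReal Cu' * ‖θ t x‖ₑ := by
                refine lintegral_mono_ae ?_
                filter_upwards [ht] with x hx
                gcongr
                rw [← ofReal_norm]
                exact ENNReal.ofReal_le_ofReal hx
            _ = ENNReal.ofReal Cu' * eLpNorm (θ t) 1 volume := by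
                rw [lintegral_const_mul' _ _ ENNReal.ofReal_ne_top, eLpNorm_one_eq_lintegral_enorm]
            _ ≤ ENNReal.ofReal Cu' * eLpNorm (θ t) 2 volume := by
                gcongr
                exact eLpNorm_le_eLpNorm_of_exponent_le one_le_two htm
            _ ≤ ENNReal.ofReal Cu' * ((E.toNNReal : ℝ≥0∞)) ^ (1 / 2 : ℝ) := by
                gcongr
                rw [FunctionSpaces.eLpNorm_two_eq_pow_two_rpow_half, FunctionSpaces.eLpNorm_two_pow_two_eq_lintegral]
                exact ENNReal.rpow_le_rpow htW (by norm_num)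
      _ < ⊤ := by
          rw [lintegral_const, Measure.restrict_apply_univ]
          exact ENNReal.mul_lt_top (ENNReal.mul_lt_top ENNReal.ofReal_lt_top
            (ENNReal.rpow_lt_top_of_nonneg (by norm_num) ENNReal.coe_ne_top)) measure_Ioo_lt_top

omit [DecidableEq d] in
/-- `‖a - b‖² ≤ 2‖a‖² + 2‖b‖²`. [cite: Grafakos2014, Prop. 3.2.7 (3)] -/
private theorem norm_sub_sq_le (a b : ℂ) : ‖a - b‖ ^ 2 ≤ 2 * ‖a‖ ^ 2 + 2 * ‖b‖ ^ 2 := by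
  have h := norm_sub_le a b
  nlinarith [norm_nonneg (a - b), norm_nonneg a, norm_nonneg b, sq_nonneg (‖a‖ - ‖b‖)]

/-- **Strong `L²` continuity from continuous coefficients and uniformly small tails**: a field
with `θ(t) ∈ L²` for every `t ∈ [0,T]`, time-continuous Fourier coefficients and frequency tails
small uniformly in `t ∈ [0,T]` is the `L²`-continuous representative on `[0,T]`
(`Torus.IsL2ContinuousOn`): by Parseval `‖θ(t) - θ(t₀)‖² = ∑ₖ |θ̂(t)(k) - θ̂(t₀)(k)|²`, finitely many
modes are continuous and the rest is uniformly small. [cite: Grafakos2014, Prop. 3.2.7 (3)] -/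
theorem isL2ContinuousOn_of_coeff (hθ : IsL2Field T E θ)
    (hcont : ∀ k, ContinuousOn (fun t => mFourierCoeff (fun x => (θ t x : ℂ)) k) (Icc 0 T))
    (htail : ∀ ε : ℝ, 0 < ε → ∃ N : ℕ, ∀ t ∈ Icc 0 T, ∀ F : Finset (d → ℤ),
      ∑ k ∈ F \ freqBall N, ‖mFourierCoeff (fun x => (θ t x : ℂ)) k‖ ^ 2 ≤ ε) :
    IsL2ContinuousOn (Icc 0 T) θ := by
  refine ⟨hθ.memLp, fun t₀ ht₀ => ?_⟩
  set c : ℝ → (d → ℤ) → ℂ := fun t k => mFourierCoeff (fun x => (θ t x : ℂ)) k with hc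
  -- Parseval for the difference of two slices
  have hP : ∀ t ∈ Icc 0 T, HasSum (fun k => ‖c t k - c t₀ k‖ ^ 2) (scalarL2Sq (θ t - θ t₀)) := by
    intro t ht
    have hm : MemLp (θ t - θ t₀) 2 volume := (hθ.memLp t ht).sub (hθ.memLp t₀ ht₀)
    have h := hasSum_sq_norm_mFourierCoeff_ofReal hm
    have hcoef : ∀ k, mFourierCoeff (fun x => (((θ t - θ t₀) x : ℝ) : ℂ)) k = c t k - c t₀ k := by
      intro k
      have e : (fun x => (((θ t - θ t₀) x : ℝ) : ℂ)) = (fun x => ((θ t x : ℝ) : ℂ)) - fun x => ((θ t₀ x : ℝ) : ℂ) := by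
        funext x; simp only [Pi.sub_apply, Complex.ofReal_sub]
      rw [e, mFourierCoeff_sub ((hθ.memLp t ht).integrable one_le_two).ofReal
        ((hθ.memLp t₀ ht₀).integrable one_le_two).ofReal]
    simp only [hcoef] at h
    exact h
  refine Metric.tendsto_nhdsWithin_nhds.2 fun ε hε => ?_
  obtain ⟨N, hN⟩ := htail (ε / 8) (by positivity)
  -- the finitely many low modes are continuous
  set S : ℝ → ℝ := fun t => ∑ k ∈ freqBall N, ‖c t k - c t₀ k‖ ^ 2 with hS
  have hSc : ContinuousWithinAt S (Icc 0 T) t₀ :=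
    (continuousOn_finsetSum _ fun k _ => (((hcont k).sub continuousOn_const).norm).pow 2) t₀ ht₀
  have hS0 : S t₀ = 0 := by simp [hS]
  have hSt : Tendsto S (𝓝[Icc 0 T] t₀) (𝓝 0) := by
    have h := hSc.tendsto
    rwa [hS0] at h
  obtain ⟨δ, hδ, hδS⟩ := Metric.tendsto_nhdsWithin_nhds.1 hSt (ε / 2) (by positivity)
  refine ⟨δ, hδ, fun t ht hdist => ?_⟩
  have hSε : S t < ε / 2 := by
    have h := hδS ht hdist
    rw [Real.dist_eq, sub_zero, abs_of_nonneg (Finset.sum_nonneg fun _ _ => sq_nonneg _)] at h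
    exact h
  -- every finite sum of `‖c t k - c t₀ k‖²` is at most `S t + ε/2`
  have hfin : ∀ F : Finset (d → ℤ), ∑ k ∈ F, ‖c t k - c t₀ k‖ ^ 2 ≤ S t + ε / 2 := by
    intro F
    rw [← Finset.sum_filter_add_sum_filter_not F (fun k => k ∈ freqBall N)]
    refine add_le_add ?_ ?_
    · refine Finset.sum_le_sum_of_subset_of_nonneg (fun k hk => (Finset.mem_filter.1 hk).2) ?_
      exact fun _ _ _ => sq_nonneg _
    · rw [← Finset.sdiff_eq_filter]
      calc ∑ k ∈ F \ freqBall N, ‖c t k - c t₀ k‖ ^ 2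
          ≤ ∑ k ∈ F \ freqBall N, (2 * ‖c t k‖ ^ 2 + 2 * ‖c t₀ k‖ ^ 2) :=
            Finset.sum_le_sum fun k _ => norm_sub_sq_le _ _
        _ = 2 * ∑ k ∈ F \ freqBall N, ‖c t k‖ ^ 2 + 2 * ∑ k ∈ F \ freqBall N, ‖c t₀ k‖ ^ 2 := by
            rw [Finset.sum_add_distrib, Finset.mul_sum, Finset.mul_sum]
        _ ≤ 2 * (ε / 8) + 2 * (ε / 8) := add_le_add (mul_le_mul_of_nonneg_left (hN t ht F) zero_le_two)
            (mul_le_mul_of_nonneg_left (hN t₀ ht₀ F) zero_le_two)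
        _ = ε / 2 := by ring
  have hle : scalarL2Sq (θ t - θ t₀) ≤ S t + ε / 2 := by
    rw [← (hP t ht).tsum_eq]
    exact (hP t ht).summable.tsum_le_of_sum_le hfin
  rw [Real.dist_eq, sub_zero, abs_of_nonneg (scalarL2Sq_nonneg _)]
  linarith

namespace MildData

variable [Nonempty d] (P : MildData d)

omit [Nonempty d] in
/-- **Uniform tails of the undamped mild solution**: for the damped fixed point `w`,
`𝓕(e^{λt}w(t))(k) = e^{λt}(e^{-(νₖ+λ)t}θ̂₀(k) - D^λ(w)(t)(k))`, and both the datum tail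
`∑_{k∉F_N} |θ̂₀(k)|²` and the Duhamel tail are small uniformly in `t ∈ [0,T]`. [cite: Grafakos2014, Prop. 3.2.7 (3)] -/
theorem undamp_tail {w : ℝ → UnitAddTorus d → ℝ} (hw : IsL2Field P.T (P.B ^ 2) w)
    (hweq : ∀ t ∈ Icc 0 P.T, ∀ k, mFourierCoeff (fun x => (w t x : ℂ)) k = mildMap P.κ P.a P.lam P.u P.θ₀ w t k)
    {ε : ℝ} (hε : 0 < ε) :
    ∃ N : ℕ, ∀ t ∈ Icc 0 P.T, ∀ F : Finset (d → ℤ),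
      ∑ k ∈ F \ freqBall N, ‖mFourierCoeff (fun x => (P.undamp w t x : ℂ)) k‖ ^ 2 ≤ ε := by
  set R : ℝ := Real.exp (P.lam * P.T) ^ 2 with hR
  have hR0 : 0 < R := by positivity
  -- datum tail
  have hdat : Tendsto (fun N => ∫ x, (P.θ₀ x - scalarTruncate N P.θ₀ x) ^ 2) atTop (𝓝 0) :=
    tendsto_integral_sq_sub_scalarTruncate P.hθ₀
  obtain ⟨N₁, hN₁⟩ := (hdat.eventually (gt_mem_nhds (show (0:ℝ) < ε / (4 * R) by positivity))).exists_forall_of_atTop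
  obtain ⟨N₂, hN₂⟩ := exists_sum_sdiff_norm_sq_duhamelCoeff_le P.hu hw P.ha P.hκ P.hlam
    (show (0:ℝ) < ε / (4 * R) by positivity)
  refine ⟨max N₁ N₂, fun t ht F => ?_⟩
  have hsub : ∀ {N M : ℕ}, N ≤ M → F \ freqBall M ⊆ F \ freqBall N := fun h =>
    Finset.sdiff_subset_sdiff subset_rfl (freqBall_mono h)
  -- pointwise: `‖𝓕(θ t) k‖² ≤ R (2‖θ̂₀ k‖² + 2‖D k‖²)`
  have hpt : ∀ k, ‖mFourierCoeff (fun x => (P.undamp w t x : ℂ)) k‖ ^ 2 ≤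
      R * (2 * ‖mFourierCoeff (fun x => (P.θ₀ x : ℂ)) k‖ ^ 2 + 2 * ‖duhamelCoeff P.κ P.a P.lam P.u w t k‖ ^ 2) := by
    intro k
    rw [P.mFourierCoeff_undamp w t k, hweq t ht k, mildMap_apply, norm_mul, mul_pow, Complex.norm_real,
      Real.norm_of_nonneg (Real.exp_pos _).le]
    refine mul_le_mul ?_ ((norm_sub_sq_le _ _).trans ?_) (sq_nonneg _) hR0.le
    · exact pow_le_pow_left₀ (Real.exp_pos _).le (Real.exp_le_exp.2 (mul_le_mul_of_nonneg_left ht.2 P.hlam.le)) 2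
    · refine add_le_add (mul_le_mul_of_nonneg_left ?_ zero_le_two) le_rfl
      rw [norm_mul, mul_pow, Complex.norm_real, Real.norm_of_nonneg (Real.exp_pos _).le]
      have h1 : Real.exp (-((diagRate P.κ P.a k + P.lam) * t)) ≤ 1 := by
        rw [Real.exp_le_one_iff, neg_nonpos]
        exact mul_nonneg (add_nonneg (diagRate_nonneg P.hκ.le (fun i => (P.ha i).le) k) P.hlam.le) ht.1
      calc Real.exp (-((diagRate P.κ P.a k + P.lam) * t)) ^ 2 * ‖mFourierCoeff (fun x => (P.θ₀ x : ℂ)) k‖ ^ 2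
          ≤ 1 ^ 2 * ‖mFourierCoeff (fun x => (P.θ₀ x : ℂ)) k‖ ^ 2 := by gcongr
        _ = _ := by rw [one_pow, one_mul]
  -- datum tail over `F \ F_N`: Bessel beyond the ball
  have hdat' : ∑ k ∈ F \ freqBall (max N₁ N₂), ‖mFourierCoeff (fun x => (P.θ₀ x : ℂ)) k‖ ^ 2 < ε / (4 * R) := by
    refine lt_of_le_of_lt ?_ (hN₁ (max N₁ N₂) (le_max_left _ _))
    rw [integral_sq_sub_scalarTruncate P.hθ₀, le_sub_iff_add_le, ← Finset.sum_union Finset.sdiff_disjoint]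
    exact sum_le_hasSum _ (fun _ _ => sq_nonneg _) (hasSum_sq_norm_mFourierCoeff_ofReal P.hθ₀)
  have hduh : ∑ k ∈ F \ freqBall (max N₁ N₂), ‖duhamelCoeff P.κ P.a P.lam P.u w t k‖ ^ 2 ≤ ε / (4 * R) :=
    (Finset.sum_le_sum_of_subset_of_nonneg (hsub (le_max_right N₁ N₂)) fun _ _ _ => sq_nonneg _).trans (hN₂ t ht F)
  calc ∑ k ∈ F \ freqBall (max N₁ N₂), ‖mFourierCoeff (fun x => (P.undamp w t x : ℂ)) k‖ ^ 2
      ≤ ∑ k ∈ F \ freqBall (max N₁ N₂), R * (2 * ‖mFourierCoeff (fun x => (P.θ₀ x : ℂ)) k‖ ^ 2 +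
          2 * ‖duhamelCoeff P.κ P.a P.lam P.u w t k‖ ^ 2) := Finset.sum_le_sum fun k _ => hpt k
    _ = R * (2 * ∑ k ∈ F \ freqBall (max N₁ N₂), ‖mFourierCoeff (fun x => (P.θ₀ x : ℂ)) k‖ ^ 2 +
          2 * ∑ k ∈ F \ freqBall (max N₁ N₂), ‖duhamelCoeff P.κ P.a P.lam P.u w t k‖ ^ 2) := by
        rw [← Finset.mul_sum, Finset.sum_add_distrib, Finset.mul_sum, Finset.mul_sum]
    _ ≤ R * (2 * (ε / (4 * R)) + 2 * (ε / (4 * R))) := by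
        refine mul_le_mul_of_nonneg_left (add_le_add ?_ ?_) hR0.le
        · exact mul_le_mul_of_nonneg_left hdat'.le zero_le_two
        · exact mul_le_mul_of_nonneg_left hduh zero_le_two
    _ = ε := by field_simp; ring


omit [DecidableEq d] [Nonempty d] in
/-- **The mild solution has the right datum**: `𝓕(θ(0)) = θ̂₀` (the Duhamel integral over `(0,0]`
vanishes), hence `θ(0) = θ₀` a.e. [cite: Pazy1983, Ch. 4 §4.2, (2.3) and Def. 2.3 (mild solution), p. 106] -/
theorem ae_eq_datum_of_mild {θ : ℝ → UnitAddTorus d → ℝ} {E : ℝ} (hθ : IsL2Field P.T E θ)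
    (hmild : ∀ t ∈ Icc 0 P.T, ∀ k, mFourierCoeff (fun x => (θ t x : ℂ)) k = mildMap P.κ P.a 0 P.u P.θ₀ θ t k) :
    θ 0 =ᵐ[volume] P.θ₀ := by
  refine ae_eq_of_forall_mFourierCoeff_ofReal_eq ((hθ.memLp 0 (left_mem_Icc.2 P.hT.le)).integrable one_le_two)
    (P.hθ₀.integrable one_le_two) fun k => ?_
  rw [hmild 0 (left_mem_Icc.2 P.hT.le) k, mildMap_apply, duhamelCoeff_apply]
  simp

end MildData

end Existence


end Torus

end Literature.Analysis.FluidPDE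

end
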